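import Summits.HodgeConjecture.HodgeConjecture.Cruxes.BlochSeedDiscOne.SeedChecker
import Literature.AlgebraicGeometry.HodgeTheory.WeilCharacterDecomposition
import HarnessLib

/-!
# `Cruxes/BlochSeedDiscOne/SeedCheckerBalanced.lean` — SEED CHECKER v8, satellite §11 of `SeedChecker.lean` (crux
# `EightfoldBlochSeeds.BlochSeedDiscOne`, item stmt-HodgeConjecture-18881): THE `ψ`-BALANCED CHARACTER, `ℚ[h]₈ ∩ W_K = 0`,
# AND THE HONEST FORMS OF (σ) AND (A1@Z) — the `W_K`-coordinate `w` (`μ`) and the `h⁴`-coordinate `q` of a class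
# `q·h_K⁴ + w` are DETERMINED BY THE CLASS, for the stub's own binders `(e, a)` WHATEVER THEY ARE

HONEST FRAMING. Typed by planner seat `hsemireg-c5c8-1` (g7; director-hodge g20 MINT block A5 «C5–C8 — (σ) the Hodge class
check, (A1)-cleanliness AT THE SEED, pad4-tower compatibility with `stub_rung_pad4_seedAt`'s binders, disc-one — as predicates
on (design json, presentation); flag the vacuous ∕ implied ones; nothing proved toward the summit») for the computation cell
`pub-hsemireg`. Line of record: `Cruxes/BlochSeedDiscOne/Lines/birth.lean` 814a6a70c14e831a, stub `stub_rung_pad4_seedAt`.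
This satellite imports `SeedChecker.lean` v4 (13437bb9848c3c36) UNCHANGED plus ONE Literature file not in v4's closure,
`HodgeTheory/WeilCharacterDecomposition` (the character decomposition `H²ᵖ = ⊕_{a+b=2p} χ_{a,b}` and `W_K ⊓ nonWeil = ⊥`,
sorry-free), and sits BESIDE the satellites v5 `SeedCheckerPorteous.lean` (0e6fc41a4915935f), v6.2 `SeedCheckerKit.lean`
(91dde06873600691), v7.1 `SeedCheckerFrame.lean` (b022e95d14b044f4) — none of which it imports (import hygiene; they were
not built on the farm at typing time) and none of whose declaration names it reuses (all 49 names below are new in the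
shared namespace `…Cruxes.BlochSeedDiscOne.SeedChecker`).

NOTHING HERE IS PROVED TOWARD HC ∕ HC_CM ∕ HC_AV ∕ №4 ∕ 26512 ∕ 18881 ∕ H2. Every `theorem` below is a kernel-checked
statement about the TREE's cohomological objects (`pullbackEigenclasses`, `weilClassesOf`, `cupPowTwo`, v4's `WeilFrame ∕
CleanAtSeed ∕ RealisedBy ∕ ClassCheck ∕ SeedCertificate ∕ SheafSeedCheck`) — linear algebra of eigenclasses and the Kähler
package already in `Literature/` — and NOT a rung: no bundle, section, zero scheme, design or Weil frame is exhibited; the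
stub stays open; this is EVIDENCE + a TYPED FILE (a checker that exists before a candidate does).

WHAT v8 ADDS (g6 memo §3 successor item 3 «`ℚ[h]₄ ∩ W = 0` — make (σ) honest», done STRUCTURALLY, no numerics):

§11.1 `balancedChar d p (x, y) = (x + iy√d)ᵖ(x − iy√d)ᵖ` (`= (x² + d y²)ᵖ`, `balancedChar_eq_norm_pow`) — spelled exactly as
  the `a = b = p` summand of the tree's character decomposition; `cupPowTwo_mem_balanced` (`h ∈ χ_{1,1} ⟹ hᵖ ∈ χ_{p,p}`,
  multiplicativity of pull-backs, `cupProduct_mem_pullbackEigenclasses`); `natCast_smul_add_map_mem_balanced`: for `ψ² = −d`,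
  `d ≥ 1`, the `K`-symmetrisation `d·c + ψ^*c` of EVERY `c ∈ H²` is balanced (`ψ^*` acts on `χ_{2,0}, χ_{1,1}, χ_{0,2}` by
  `−d, d, −d`; `iSup_pullbackEigenclasses_weilCharacter_eq_top` + `Submodule.iSup_induction`); product classes
  `pr_A^*a + pr_B^*b` (`map_fst_add_map_snd_mem_pullbackEigenclasses`).
§11.2 THE TOWER: on a CM curve `H²(E₀) = χ_{1,1}` (`pullbackEigenclasses_two_balanced_eq_top_of_dim_eq_one`: the test isogeny
  `x·𝟙 + y·ψ₀` acts on `H²(E₀)` by its degree `x² + d y²`); hence `h_S, h_{S²}, h_{S³}, h_std` are balanced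
  (`hSurf ∕ hPad2 ∕ hPad3 ∕ hStd_mem_balanced`), `h_stdᵖ ∈ χ_{p,p}` (`cupPowTwo_hStd_mem_balanced`), and — binder-literally for
  the stub — `symH (pad4Action E₀ ψ₀) e a ∈ χ_{1,1}` for EVERY projective embedding `e` and EVERY class `a`
  (`symH_mem_balanced`, `cupPowTwo_symH_mem_balanced`): no compatibility of `(e, a)` with any frame is needed.
§11.3 `χ_{n,n} ⊓ W_K = ⊥` in degree `2n`, `n, d ≥ 1` (`balanced_inf_weilClassesOf_eq_bot`, from the tree's
  `weilClassesOf_inf_nonWeil_eq_bot`) — in particular `ℚ[h]₂ₙ ∩ W_K = 0`; coordinates in `χ_{n,n} ⊕ W_K` are unique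
  (`eq_of_balanced_add_weil_eq`); balanced ⟹ `ψ^*c = dᵖ·c` (`map_eq_pow_smul_of_mem_balanced`; at `d = 1` balanced classes
  are `ψ`-invariant, `map_eq_self_of_mem_balanced_one` — v4's `map_pad4Action_hStd` is the case `h_std`).
§11.4 CONSEQUENCES FOR THE CHECKER (all at `d = 1`, `n = 4`): `WeilFrame.eq_of_wOf_eq` (`μ ↦ wOf μ` injective);
  `symH_smul_cupPowTwo_add_weil_unique` (FOR THE STUB'S BINDERS: `s·h_K⁴ + w = s'·h_K⁴ + w'`, `w, w' ∈ W_K` ⟹ `w = w'` and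
  `s·h_K⁴ = s'·h_K⁴`); `symH_smul_cupPowTwo_add_mem_span_iff ∕ _mem_balanced_iff` (the stub's conjunct `w ≠ 0` ⟺ the
  supported class `s·h_K⁴ + w` is NOT in `ℂ·h_K⁴` ⟺ NOT in `χ_{4,4} ⊇ ℚ[h_K]₈`); `WeilFrame.mu_eq_of_eq`; `cleanAtSeed_mu_unique`
  (+ `_hStd_ ∕ _symH_` forms: (A1@Z) NAMES ONE `μ` — the `W`-coordinate of `ch₄(𝓔)` is a property of the sheaf);
  `realisedBy_mu_eq` (one sheaf realises one `μ`); `smul_cupPowTwo_add_wOf_mem_span_iff ∕ _mem_balanced_iff`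
  (`s·h⁴ + wOf μ ∈ ℂ·h⁴ ⟺ μ = 0`); `ClassCheck.not_mem_span ∕ .not_mem_balanced`, `SeedCertificate.supported_not_mem_span`.
§11.5 KÄHLER: `cupPowTwo_map_ι_ne_zero ∕ cupPowTwo_symH_ne_zero(')` (`(e^*a)ᵖ ≠ 0`, `h_Kᵖ ≠ 0` for `p ≤ 8`, EVERY `(e, a)` with
  `a` rational `≠ 0`: `e^*a = s·H`, `H` the Kähler class of the restricted Fubini–Study form, `H + ψ^*H` Kähler;
  `exists_real_map_eq_smul_of_pullback_eq_fubiniStudy`, `IsKaehlerClassVia.natCast_smul_add_map`, `IsKaehlerClass.cupPowTwo_ne_zero`);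
  `cupPowTwo_hStd_ne_zero` (given v4's `Polarisation`, `p ≤ 8`, incl. `p = 0`); hence BOTH coordinates are determined
  (`WeilFrame.mu_eq_and_eq_of_eq`, `symH_ratCast_smul_add_wOf_injective`: `q·h_K⁴ + wOf μ = q'·h_K⁴ + wOf μ'` ⟹ `μ = μ'` ∧
  `q = q'`), and ONE SHEAF REALISES ONE CLASS-DATA VECTOR: `realisedBy_coeff_eq ∕ realisedBy_unique ∕ sheafSeedCheck_unique`
  (two designs realised by ∕ passing the sheaf-seed checker with the same sheaf have the same `(μ, c₀, …, c₈)`).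

FLAGS (MINT «flag any that is vacuous or already implied by C0–C4»), sharpened by v8:
* (σ) DESIGN HALF ≡ C0's `μ ≠ 0`, and this is now an HONEST EQUIVALENCE, not a proxy: for every `(e, a)` and every `q`,
  `q·h_K⁴ + wOf μ ∈ ℂ·h_K⁴ ⟺ μ = 0` (indeed `∈ χ_{4,4} ⟺ μ = 0`, and at the CM anchor `ℚ[h_K]₈ ⊆ χ_{4,4}`): «the seed's class is
  the target Weil ∕ non-divisor-polynomial class» holds EXACTLY when `μ ≠ 0`. So (σ)'s design half is IMPLIED BY C0 with no
  loss; its object half (`q·h_K⁴ + wOf μ` supported on `Z`) remains MATH (Fulton 14.1 ∕ purity), untyped beyond v4's predicate.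
* (A1@Z) is a GENUINE, SINGLE-VALUED condition on `ch(𝓔)`: its `μ` (and, with O-pol, its `q` and every `c_p`) is determined by
  the class (`cleanAtSeed_mu_unique`, `realisedBy_unique`); it is implied by (A1) + a faithful realisation (v4
  `cleanAtSeed_of_realisedBy`) and is NOT implied by C0–C4 alone (it speaks about the sheaf). New: realisation is INJECTIVE on
  class data — a sheaf cannot realise two designs with different `(μ, c_p)`.
* pad4-TOWER COMPATIBILITY of the polarisation with the stub's binders is VACUOUS AS A CHECK: `symH ψ e a` is balanced — hence
  `ψ`-invariant and with `ℚ[h_K]₈ ∩ W_K = 0` — for EVERY `(e, a)`; and `h_std` is balanced at every level of the tower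
  `E₀ ⊂ S ⊂ S² ⊂ S³ ⊂ S⁴` by equivariance of the projections. Nothing about `(e, a)` needs checking for the decomposition to be
  well defined; only O-pol (`e^*a = t·h_std`, v4) links the stub's `h_K` to the frame's `h_std`.
* DISC-ONE is in the TYPES, not a check: §11.1–§11.3 hold for every `d ≥ 1` (`balancedChar d`); `d = 1` enters only through
  the literal `1 •` of `symH` and `pad4Action_comp_self` (`ψ² = −1`).

No `sorry`, no new axiom (`--axioms`: propext, Classical.choice, Quot.sound), no instance, no notation, no unsafe
reducibility option. [cite: vanGeemen1994HodgeAV, 4.8–4.9, Lemma 5.2, Thm. 6.12] [cite: VoisinHodgeI2002, §3.3.2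
Lemma 3.16, Cor. 3.9, Thm. 7.10] [cite: HatcherAT2002, §3.2]
-/

noncomputable section

set_option linter.dupNamespace false

open CategoryTheory AlgebraicGeometry
open Literature.AlgebraicGeometry Literature.AlgebraicGeometry.Motives Literature.AlgebraicGeometry.HodgeTheory
open Literature.AlgebraicTopology.SingularHomology

namespace Summit.HodgeConjecture.HodgeConjecture.Cruxes.BlochSeedDiscOne.SeedChecker

open Summit.HodgeConjecture.HodgeConjecture.Cruxes.BlochSeedDiscOne.Anchor
open Summit.Ventures.HSemireg Summit.Ventures.HSemireg.Pad4Tower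

/-! ## §11.1 The balanced character `χ_{p,p}(x, y) = (x + iy√d)ᵖ (x − iy√d)ᵖ = (x² + d y²)ᵖ` and its eigenclasses -/

section BalancedCharacter

/-- **the `ψ`-BALANCED character of bidegree `(p, p)`**: `χ_{p,p}(x, y) = (x + iy√d)ᵖ·(x − iy√d)ᵖ` (`= (x² + d·y²)ᵖ`, the
`p`-th power of the NORM of `x + y√-d`), spelled exactly as the summand `a = b = p` of the tree's character decomposition
`H²ᵖ = ⊕_{a+b=2p} ⋀ᵃV₊ ⊗ ⋀ᵇV₋` (`WeilCharacterDecomposition`). [cite: vanGeemen1994HodgeAV, 4.8–4.9] -/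
def balancedChar (d p : ℕ) : ℕ → ℕ → ℂ := fun x y =>
  ((x : ℂ) + (y : ℂ) * Complex.I * (Real.sqrt d : ℂ)) ^ p * ((x : ℂ) - (y : ℂ) * Complex.I * (Real.sqrt d : ℂ)) ^ p

theorem balancedChar_apply (d p x y : ℕ) : balancedChar d p x y =
    ((x : ℂ) + (y : ℂ) * Complex.I * (Real.sqrt d : ℂ)) ^ p * ((x : ℂ) - (y : ℂ) * Complex.I * (Real.sqrt d : ℂ)) ^ p :=
  rfl

/-- `χ_{p,p}(x, y) = (x² + d y²)ᵖ` — the norm form. -/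
theorem balancedChar_eq_norm_pow (d p x y : ℕ) :
    balancedChar d p x y = (((x : ℂ)) ^ 2 + (d : ℂ) * ((y : ℂ)) ^ 2) ^ p := by
  rw [balancedChar_apply, ← mul_pow]
  congr 1
  linear_combination (-((y : ℂ)) ^ 2) * I_mul_sqrt_sq d

theorem balancedChar_one_pow (d p x y : ℕ) : balancedChar d 1 x y ^ p = balancedChar d p x y := by
  rw [balancedChar_apply, balancedChar_apply, pow_one, pow_one, mul_pow]

/-- at the test value `(0, 1)` (the endomorphism `ψ` itself) the balanced character of bidegree `(1,1)` is `d`: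
`(i√d)(−i√d) = d`. -/
theorem balancedChar_one_zero_one (d : ℕ) : balancedChar d 1 0 1 = (d : ℂ) := by
  rw [balancedChar_eq_norm_pow]
  push_cast
  ring

variable {B : AbelianVariety ℂ} {ψ : B ⟶ B}

/-- cup powers of a `χ`-eigenclass of degree `2` are `χᵖ`-eigenclasses (multiplicativity of pull-backs). -/
theorem cupPowTwo_mem_pullbackEigenclasses_pow {χ : ℕ → ℕ → ℂ} {h : complexBetti B.X 2}
    (hh : h ∈ pullbackEigenclasses B ψ 2 χ) (p : ℕ) :
    cupPowTwo h p ∈ pullbackEigenclasses B ψ (2 * p) (fun x y => χ x y ^ p) := by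
  induction p with
  | zero =>
    rw [mem_pullbackEigenclasses_iff]
    intro x y
    rw [cupPowTwo_zero, pow_zero, one_smul]
    exact singularCohomology.map_one _
  | succ p ih =>
    have h' := cupProduct_mem_pullbackEigenclasses (two_mul_add_two p) ih hh
    rw [mem_pullbackEigenclasses_iff] at h' ⊢
    intro x y
    rw [cupPowTwo_succ, h' x y, pow_succ]

/-- **powers of a balanced class are balanced**: `h ∈ χ_{1,1}` ⟹ `hᵖ ∈ χ_{p,p}`. -/
theorem cupPowTwo_mem_balanced {d : ℕ} {h : complexBetti B.X 2}
    (hh : h ∈ pullbackEigenclasses B ψ 2 (balancedChar d 1)) (p : ℕ) :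
    cupPowTwo h p ∈ pullbackEigenclasses B ψ (2 * p) (balancedChar d p) := by
  have h' := cupPowTwo_mem_pullbackEigenclasses_pow hh p
  rw [mem_pullbackEigenclasses_iff] at h' ⊢
  intro x y
  rw [h' x y, balancedChar_one_pow]

/-- **the `K`-symmetrisation `d·c + ψ^*c` of ANY degree-`2` class is balanced** (`ψ ≫ ψ = -d`, `d ≥ 1`): in the character
decomposition `H² = χ_{2,0} ⊕ χ_{1,1} ⊕ χ_{0,2}` the pull-back `ψ^* = (0·𝟙 + 1·ψ)^*` acts by `−d, d, −d`, so `d·c + ψ^*c`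
kills the two outer components and doubles the balanced one. In particular the stub's `h_K = symH ψ e a = 1·e^*a + ψ^*e^*a`
is balanced FOR EVERY `(e, a)`. [cite: vanGeemen1994HodgeAV, 4.9 and 5.2] -/
theorem natCast_smul_add_map_mem_balanced {d : ℕ} (hd : 0 < d) (hψ : ψ ≫ ψ = -(d • 𝟙 B))
    (c : complexBetti B.X 2) :
    (d : ℂ) • c + complexBetti.map ψ.hom.hom.hom 2 c ∈ pullbackEigenclasses B ψ 2 (balancedChar d 1) := by
  have hc : c ∈ ⨆ (a : ℕ) (b : ℕ) (_ : a + b = 2) (_ : a ≤ B.dim) (_ : b ≤ B.dim),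
      pullbackEigenclasses B ψ 2 (fun x y =>
        ((x : ℂ) + (y : ℂ) * Complex.I * (Real.sqrt d : ℂ)) ^ a *
          ((x : ℂ) - (y : ℂ) * Complex.I * (Real.sqrt d : ℂ)) ^ b) := by
    rw [iSup_pullbackEigenclasses_weilCharacter_eq_top hd hψ 2]
    trivial
  have hzero : (d : ℂ) • (0 : complexBetti B.X 2) + complexBetti.map ψ.hom.hom.hom 2 0 ∈
      pullbackEigenclasses B ψ 2 (balancedChar d 1) := by
    rw [smul_zero, map_zero, add_zero]
    exact Submodule.zero_mem _
  have hadd : ∀ u v : complexBetti B.X 2,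
      (d : ℂ) • u + complexBetti.map ψ.hom.hom.hom 2 u ∈ pullbackEigenclasses B ψ 2 (balancedChar d 1) →
      (d : ℂ) • v + complexBetti.map ψ.hom.hom.hom 2 v ∈ pullbackEigenclasses B ψ 2 (balancedChar d 1) →
      (d : ℂ) • (u + v) + complexBetti.map ψ.hom.hom.hom 2 (u + v) ∈ pullbackEigenclasses B ψ 2 (balancedChar d 1) := by
    intro u v hu hv
    rw [smul_add, map_add, add_add_add_comm]
    exact Submodule.add_mem _ hu hv
  refine Submodule.iSup_induction _ (motive := fun c => (d : ℂ) • c + complexBetti.map ψ.hom.hom.hom 2 c ∈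
      pullbackEigenclasses B ψ 2 (balancedChar d 1)) hc (fun a c hc => ?_) hzero hadd
  refine Submodule.iSup_induction _ (motive := fun c => (d : ℂ) • c + complexBetti.map ψ.hom.hom.hom 2 c ∈
      pullbackEigenclasses B ψ 2 (balancedChar d 1)) hc (fun b c hc => ?_) hzero hadd
  refine Submodule.iSup_induction _ (motive := fun c => (d : ℂ) • c + complexBetti.map ψ.hom.hom.hom 2 c ∈
      pullbackEigenclasses B ψ 2 (balancedChar d 1)) hc (fun hab c hc => ?_) hzero hadd
  refine Submodule.iSup_induction _ (motive := fun c => (d : ℂ) • c + complexBetti.map ψ.hom.hom.hom 2 c ∈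
      pullbackEigenclasses B ψ 2 (balancedChar d 1)) hc (fun _ c hc => ?_) hzero hadd
  refine Submodule.iSup_induction _ (motive := fun c => (d : ℂ) • c + complexBetti.map ψ.hom.hom.hom 2 c ∈
      pullbackEigenclasses B ψ 2 (balancedChar d 1)) hc (fun _ c hc => ?_) hzero hadd
  -- `hc : c ∈ χ_{a,b}`, `a + b = 2`; the action of `ψ^* = (0·𝟙 + 1·ψ)^*` on `c`
  have hψc : complexBetti.map ψ.hom.hom.hom 2 c =
      ((Complex.I * (Real.sqrt d : ℂ)) ^ a * (-(Complex.I * (Real.sqrt d : ℂ))) ^ b) • c := by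
    have h01 := (mem_pullbackEigenclasses_iff.mp hc) 0 1
    have e : ((0 : ℕ) • 𝟙 B + (1 : ℕ) • ψ : B ⟶ B) = ψ := by simp
    rw [e] at h01
    change complexBetti.map ψ.hom.hom.hom 2 c = _ at h01
    rw [h01]
    congr 1
    push_cast
    ring
  have hsq : (Complex.I * (Real.sqrt d : ℂ)) ^ 2 = -(d : ℂ) := I_mul_sqrt_sq d
  rcases Nat.lt_or_ge a 1 with ha | ha
  · -- `a = 0`, `b = 2`: `ψ^*c = -d·c`, the symmetrisation vanishes
    obtain rfl : a = 0 := by omega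
    obtain rfl : b = 2 := by omega
    rw [hψc, pow_zero, one_mul, neg_pow, hsq]
    norm_num
  rcases Nat.lt_or_ge a 2 with ha2 | ha2
  · -- `a = b = 1`: `c` is balanced itself, `ψ^*c = d·c`
    obtain rfl : a = 1 := by omega
    obtain rfl : b = 1 := by omega
    have hc' : c ∈ pullbackEigenclasses B ψ 2 (balancedChar d 1) := hc
    exact Submodule.add_mem _ (Submodule.smul_mem _ _ hc')
      (by rw [hψc]; exact Submodule.smul_mem _ _ hc')
  · -- `a = 2`, `b = 0`
    obtain rfl : a = 2 := by omega
    obtain rfl : b = 0 := by omega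
    rw [hψc, pow_zero, mul_one, hsq]
    norm_num

/-- pull-back along a `K`-equivariant homomorphism preserves balancedness (restatement of the tree's
`map_mem_pullbackEigenclasses_of_comm` in the `complexBetti.map` spelling). -/
theorem map_mem_balanced_of_comm {A : AbelianVariety ℂ} {φ : A ⟶ A} {g : B ⟶ A} (hg : g ≫ φ = ψ ≫ g)
    {d p k : ℕ} {c : complexBetti A.X k} (hc : c ∈ pullbackEigenclasses A φ k (balancedChar d p)) :
    complexBetti.map g.hom.hom.hom k c ∈ pullbackEigenclasses B ψ k (balancedChar d p) :=
  map_mem_pullbackEigenclasses_of_comm hg hc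

/-- **product classes**: `pr_A^* a + pr_B^* b` is a `χ`-eigenclass of `(A × B, φ × ψ)` if `a`, `b` are `χ`-eigenclasses of
the factors (the projections are equivariant: `prodLift_fst`, `prodLift_snd`). -/
theorem map_fst_add_map_snd_mem_pullbackEigenclasses {A : AbelianVariety ℂ} {φ : A ⟶ A} {k : ℕ} {χ : ℕ → ℕ → ℂ}
    {a : complexBetti A.X k} {b : complexBetti B.X k} (ha : a ∈ pullbackEigenclasses A φ k χ)
    (hb : b ∈ pullbackEigenclasses B ψ k χ) :
    complexBetti.map (AbelianVariety.fst A B).hom.hom.hom k a + complexBetti.map (AbelianVariety.snd A B).hom.hom.hom k b ∈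
      pullbackEigenclasses (A.prod B)
        (AbelianVariety.prodLift (AbelianVariety.fst A B ≫ φ) (AbelianVariety.snd A B ≫ ψ)) k χ :=
  Submodule.add_mem _
    (map_mem_pullbackEigenclasses_of_comm (by rw [AbelianVariety.prodLift_fst]) ha)
    (map_mem_pullbackEigenclasses_of_comm (by rw [AbelianVariety.prodLift_snd]) hb)

end BalancedCharacter

/-! ## §11.2 The CM curve: `H²(E₀)` IS the balanced line; the tower `h_S, h_{S²}, h_{S³}, h_std` and its powers are balanced -/

section Tower

variable {E₀ : AbelianVariety ℂ} {ψ₀ : E₀ ⟶ E₀} {d : ℕ}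

/-- **on a CM curve every degree-`2` class is balanced**: `H²(E₀(ℂ); ℂ) = ⋀²(V₊ ⊕ V₋) = V₊ ⊗ V₋ = χ_{1,1}` (`dim V± = 1`), read
off the tree's character decomposition with `a, b ≤ dim E₀ = 1`, `a + b = 2`. So `(x·𝟙 + y·ψ₀)^* η = (x² + d y²)·η`: the test
isogeny acts on `H²` of the curve by its DEGREE (the norm). [cite: vanGeemen1994HodgeAV, 4.9 and Lemma 5.2 (2)] -/
theorem pullbackEigenclasses_two_balanced_eq_top_of_dim_eq_one (hE : E₀.dim = 1) (hd : 0 < d)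
    (hψ : ψ₀ ≫ ψ₀ = -(d • 𝟙 E₀)) : pullbackEigenclasses E₀ ψ₀ 2 (balancedChar d 1) = ⊤ := by
  rw [eq_top_iff, ← iSup_pullbackEigenclasses_weilCharacter_eq_top hd hψ 2]
  refine iSup_le fun a ↦ iSup_le fun b ↦ iSup_le fun hab ↦ iSup_le fun ha ↦ iSup_le fun hb ↦ ?_
  rw [hE] at ha hb
  obtain rfl : a = 1 := by omega
  obtain rfl : b = 1 := by omega
  exact le_of_eq rfl

theorem mem_balanced_of_dim_eq_one (hE : E₀.dim = 1) (hd : 0 < d) (hψ : ψ₀ ≫ ψ₀ = -(d • 𝟙 E₀))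
    (η : complexBetti E₀.X 2) : η ∈ pullbackEigenclasses E₀ ψ₀ 2 (balancedChar d 1) := by
  rw [pullbackEigenclasses_two_balanced_eq_top_of_dim_eq_one hE hd hψ]
  trivial

/-- `h_S = pr₁^*η + pr₂^*η` is balanced for `φ_S = ψ₀ × (−ψ₀)` (`(−ψ₀)² = −d` as well). -/
theorem hSurf_mem_balanced (hE : E₀.dim = 1) (hd : 0 < d) (hψ : ψ₀ ≫ ψ₀ = -(d • 𝟙 E₀)) (η : complexBetti E₀.X 2) :
    hSurf E₀ η ∈ pullbackEigenclasses (weilSurf E₀) (weilSurfAct E₀ ψ₀) 2 (balancedChar d 1) := by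
  have hψ' : (-ψ₀) ≫ (-ψ₀) = -(d • 𝟙 E₀) := by rw [Preadditive.neg_comp_neg, hψ]
  exact map_fst_add_map_snd_mem_pullbackEigenclasses (mem_balanced_of_dim_eq_one hE hd hψ η)
    (mem_balanced_of_dim_eq_one hE hd hψ' η)

theorem hPad2_mem_balanced (hE : E₀.dim = 1) (hd : 0 < d) (hψ : ψ₀ ≫ ψ₀ = -(d • 𝟙 E₀)) (η : complexBetti E₀.X 2) :
    hPad2 E₀ η ∈ pullbackEigenclasses (pad2Anchor E₀) (pad2Action E₀ ψ₀) 2 (balancedChar d 1) :=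
  map_fst_add_map_snd_mem_pullbackEigenclasses (hSurf_mem_balanced hE hd hψ η) (hSurf_mem_balanced hE hd hψ η)

theorem hPad3_mem_balanced (hE : E₀.dim = 1) (hd : 0 < d) (hψ : ψ₀ ≫ ψ₀ = -(d • 𝟙 E₀)) (η : complexBetti E₀.X 2) :
    hPad3 E₀ η ∈ pullbackEigenclasses (pad3Anchor E₀) (pad3Action E₀ ψ₀) 2 (balancedChar d 1) :=
  map_fst_add_map_snd_mem_pullbackEigenclasses (hPad2_mem_balanced hE hd hψ η) (hSurf_mem_balanced hE hd hψ η)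

/-- **`h_std` is balanced** on the pad-4 anchor: `(x·𝟙 + y·ψ)^* h_std = (x² + d y²)·h_std` for all `x, y`. (At `(0, 1)`,
`d = 1`, this is v4's `map_pad4Action_hStd : ψ^* h_std = h_std`.) -/
theorem hStd_mem_balanced (hE : E₀.dim = 1) (hd : 0 < d) (hψ : ψ₀ ≫ ψ₀ = -(d • 𝟙 E₀)) (η : complexBetti E₀.X 2) :
    hStd E₀ η ∈ pullbackEigenclasses (pad4Anchor E₀) (pad4Action E₀ ψ₀) 2 (balancedChar d 1) :=
  map_fst_add_map_snd_mem_pullbackEigenclasses (hPad3_mem_balanced hE hd hψ η) (hSurf_mem_balanced hE hd hψ η)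

/-- **`h_stdᵖ ∈ χ_{p,p}`**: the degree-`2p` part of `ℚ[h_std]` is balanced of bidegree `(p, p)`. -/
theorem cupPowTwo_hStd_mem_balanced (hE : E₀.dim = 1) (hd : 0 < d) (hψ : ψ₀ ≫ ψ₀ = -(d • 𝟙 E₀))
    (η : complexBetti E₀.X 2) (p : ℕ) :
    cupPowTwo (hStd E₀ η) p ∈ pullbackEigenclasses (pad4Anchor E₀) (pad4Action E₀ ψ₀) (2 * p) (balancedChar d p) :=
  cupPowTwo_mem_balanced (hStd_mem_balanced hE hd hψ η) p

/-- **the stub's `h_K = symH ψ e a` is balanced for EVERY projective embedding `e` and EVERY class `a`** (`d = 1`: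
`symH = 1·e^*a + ψ^*e^*a` is a `K`-symmetrisation). No compatibility of `(e, a)` with the frame is needed. -/
theorem symH_mem_balanced (hψ : ψ₀ ≫ ψ₀ = -(1 • 𝟙 E₀)) (e : ProjectiveEmbedding (pad4Anchor E₀).X)
    (a : complexBetti (projectiveSpace e.n ℂ) 2) :
    symH (pad4Action E₀ ψ₀) e a ∈ pullbackEigenclasses (pad4Anchor E₀) (pad4Action E₀ ψ₀) 2 (balancedChar 1 1) :=
  natCast_smul_add_map_mem_balanced one_pos (pad4Action_comp_self hψ) (complexBetti.map e.ι 2 a)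

theorem cupPowTwo_symH_mem_balanced (hψ : ψ₀ ≫ ψ₀ = -(1 • 𝟙 E₀)) (e : ProjectiveEmbedding (pad4Anchor E₀).X)
    (a : complexBetti (projectiveSpace e.n ℂ) 2) (p : ℕ) :
    cupPowTwo (symH (pad4Action E₀ ψ₀) e a) p ∈
      pullbackEigenclasses (pad4Anchor E₀) (pad4Action E₀ ψ₀) (2 * p) (balancedChar 1 p) :=
  cupPowTwo_mem_balanced (symH_mem_balanced hψ e a) p

end Tower

/-! ## §11.3 `ℚ[h]₂ₙ ∩ W_K = 0`: the balanced part meets the Weil classes trivially; coordinates are unique -/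

section BalancedVersusWeil

variable {B : AbelianVariety ℂ}

/-- **`χ_{n,n} ⊓ W_K = 0` in degree `2n`** (`n, d ≥ 1`): the balanced eigenclasses lie in the tree's `nonWeil` complement
`⊕_{a+b=2n, a,b ≥ 1} χ_{a,b}` of `W_K = χ_{2n,0} ⊕ χ_{0,2n}`, and `W_K ⊓ nonWeil = ⊥` (`weilClassesOf_inf_nonWeil_eq_bot`,
separation of the characters at the test isogenies `x·𝟙 + ψ`). In particular `ℚ[h]₂ₙ ∩ W_K = 0` for every balanced
divisor class `h`. [cite: vanGeemen1994HodgeAV, 4.9 and Thm. 6.12] -/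
theorem balanced_inf_weilClassesOf_eq_bot {n d : ℕ} (hn : 0 < n) (hd : 0 < d) (ψ : B ⟶ B) :
    pullbackEigenclasses B ψ (2 * n) (balancedChar d n) ⊓ weilClassesOf B ψ n d = ⊥ := by
  have hle : pullbackEigenclasses B ψ (2 * n) (balancedChar d n) ≤
      ⨆ (a : ℕ) (b : ℕ) (_ : a + b = 2 * n) (_ : 0 < a) (_ : 0 < b),
        pullbackEigenclasses B ψ (2 * n) (fun x y =>
          ((x : ℂ) + (y : ℂ) * Complex.I * (Real.sqrt d : ℂ)) ^ a *
            ((x : ℂ) - (y : ℂ) * Complex.I * (Real.sqrt d : ℂ)) ^ b) :=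
    le_iSup_of_le n (le_iSup_of_le n (le_iSup_of_le (two_mul n).symm
      (le_iSup_of_le hn (le_iSup_of_le hn (le_of_eq rfl)))))
  have h := weilClassesOf_inf_nonWeil_eq_bot hn hd ψ
  exact disjoint_iff.mp ((disjoint_iff.mpr h).mono_right hle).symm

/-- **coordinates in `χ_{n,n} ⊕ W_K` are unique**: `b + w = b' + w'` with `b, b'` balanced and `w, w' ∈ W_K` forces
`b = b'` and `w = w'`. -/
theorem eq_of_balanced_add_weil_eq {n d : ℕ} (hn : 0 < n) (hd : 0 < d) {ψ : B ⟶ B}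
    {b b' w w' : complexBetti B.X (2 * n)}
    (hb : b ∈ pullbackEigenclasses B ψ (2 * n) (balancedChar d n))
    (hb' : b' ∈ pullbackEigenclasses B ψ (2 * n) (balancedChar d n))
    (hw : w ∈ weilClassesOf B ψ n d) (hw' : w' ∈ weilClassesOf B ψ n d) (h : b + w = b' + w') :
    b = b' ∧ w = w' := by
  have h1 : b - b' = w' - w := by
    rw [sub_eq_sub_iff_add_eq_add, h, add_comm]
  have hmem : b - b' ∈ pullbackEigenclasses B ψ (2 * n) (balancedChar d n) ⊓ weilClassesOf B ψ n d :=
    ⟨Submodule.sub_mem _ hb hb', by rw [h1]; exact Submodule.sub_mem _ hw' hw⟩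
  rw [balanced_inf_weilClassesOf_eq_bot hn hd ψ, Submodule.mem_bot, sub_eq_zero] at hmem
  refine ⟨hmem, ?_⟩
  rw [hmem] at h
  exact add_left_cancel h

/-- a balanced class that is also a Weil class is zero. -/
theorem eq_zero_of_mem_balanced_of_mem_weilClassesOf {n d : ℕ} (hn : 0 < n) (hd : 0 < d) {ψ : B ⟶ B}
    {c : complexBetti B.X (2 * n)} (hb : c ∈ pullbackEigenclasses B ψ (2 * n) (balancedChar d n))
    (hw : c ∈ weilClassesOf B ψ n d) : c = 0 := by
  have hmem : c ∈ pullbackEigenclasses B ψ (2 * n) (balancedChar d n) ⊓ weilClassesOf B ψ n d := ⟨hb, hw⟩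
  rwa [balanced_inf_weilClassesOf_eq_bot hn hd ψ, Submodule.mem_bot] at hmem

/-- at the test value `(0, 1)`: **a balanced class of bidegree `(p, p)` is a `ψ^*`-eigenclass of eigenvalue `dᵖ`**; at
`d = 1` balanced classes are `ψ`-INVARIANT (for `h_std` this is v4's `map_pad4Action_hStd`). The converse fails in degree
`≥ 4` (`W_K` itself is `ψ`-invariant when `4 ∣ deg`): `ψ`-invariance is strictly weaker than balancedness. -/
theorem map_eq_pow_smul_of_mem_balanced {ψ : B ⟶ B} {d p k : ℕ} {c : complexBetti B.X k}
    (hc : c ∈ pullbackEigenclasses B ψ k (balancedChar d p)) :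
    complexBetti.map ψ.hom.hom.hom k c = ((d : ℂ) ^ p) • c := by
  have h01 := (mem_pullbackEigenclasses_iff.mp hc) 0 1
  have e : ((0 : ℕ) • 𝟙 B + (1 : ℕ) • ψ : B ⟶ B) = ψ := by simp
  rw [e] at h01
  change complexBetti.map ψ.hom.hom.hom k c = _ at h01
  rw [h01, ← balancedChar_one_pow, balancedChar_one_zero_one]

theorem map_eq_self_of_mem_balanced_one {ψ : B ⟶ B} {p k : ℕ} {c : complexBetti B.X k}
    (hc : c ∈ pullbackEigenclasses B ψ k (balancedChar 1 p)) : complexBetti.map ψ.hom.hom.hom k c = c := by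
  rw [map_eq_pow_smul_of_mem_balanced hc, Nat.cast_one, one_pow, one_smul]

end BalancedVersusWeil

/-! ## §11.4 Consequences for the checker's predicates (v4): `μ` and `q·h⁴` are DETERMINED by the class -/

section CheckerConsequences

variable {E₀ : AbelianVariety ℂ} {ψ₀ : E₀ ⟶ E₀}

theorem WeilFrame.wOf_zero (F : WeilFrame E₀ ψ₀) : F.wOf 0 = 0 := by
  simp only [WeilFrame.wOf, Zsqrtd.re_zero, Zsqrtd.im_zero, Int.cast_zero, Rat.cast_zero, zero_smul, add_zero]

/-- **`μ ↦ wOf μ` is injective** (`r₁, r₂` are `ℂ`-independent: `F.indep`). -/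
theorem WeilFrame.eq_of_wOf_eq (F : WeilFrame E₀ ψ₀) {μ μ' : GaussianInt} (h : F.wOf μ = F.wOf μ') : μ = μ' := by
  have h0 : (((μ.re : ℚ) : ℂ) - ((μ'.re : ℚ) : ℂ)) • F.rOne + (((μ.im : ℚ) : ℂ) - ((μ'.im : ℚ) : ℂ)) • F.rTwo = 0 := by
    have h' : F.wOf μ - F.wOf μ' = 0 := sub_eq_zero.mpr h
    rw [← h']
    simp only [WeilFrame.wOf]
    module
  obtain ⟨hre, him⟩ := F.indep _ _ h0
  have hre' : (μ.re : ℚ) = (μ'.re : ℚ) := by exact_mod_cast sub_eq_zero.mp hre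
  have him' : (μ.im : ℚ) = (μ'.im : ℚ) := by exact_mod_cast sub_eq_zero.mp him
  ext
  · exact_mod_cast hre'
  · exact_mod_cast him'

/-- **FOR THE STUB'S OWN BINDERS** — `(e, a)` arbitrary, `w, w' ∈ W_K = weilClassesOf (S⁴, ψ) 4 1`:
`s·h_K⁴ + w = s'·h_K⁴ + w'` ⟹ `s·h_K⁴ = s'·h_K⁴` and `w = w'` (`h_K = symH ψ e a`). The Weil class `w` of a Bloch-seed
datum is determined by the supported class `s·h_K⁴ + w`; the checker READS `w` off the class. -/
theorem symH_smul_cupPowTwo_add_weil_unique (hψ : ψ₀ ≫ ψ₀ = -(1 • 𝟙 E₀)) (e : ProjectiveEmbedding (pad4Anchor E₀).X)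
    (a : complexBetti (projectiveSpace e.n ℂ) 2) {s s' : ℂ} {w w' : complexBetti (pad4Anchor E₀).X (2 * 4)}
    (hw : w ∈ weilClassesOf (pad4Anchor E₀) (pad4Action E₀ ψ₀) 4 1)
    (hw' : w' ∈ weilClassesOf (pad4Anchor E₀) (pad4Action E₀ ψ₀) 4 1)
    (h : s • cupPowTwo (symH (pad4Action E₀ ψ₀) e a) 4 + w = s' • cupPowTwo (symH (pad4Action E₀ ψ₀) e a) 4 + w') :
    s • cupPowTwo (symH (pad4Action E₀ ψ₀) e a) 4 = s' • cupPowTwo (symH (pad4Action E₀ ψ₀) e a) 4 ∧ w = w' :=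
  eq_of_balanced_add_weil_eq (by norm_num) one_pos
    (Submodule.smul_mem _ _ (cupPowTwo_symH_mem_balanced hψ e a 4))
    (Submodule.smul_mem _ _ (cupPowTwo_symH_mem_balanced hψ e a 4)) hw hw' h

/-- **THE STUB'S CONJUNCT `w ≠ 0` IS THE HODGE-CLASS CHECK (σ)**, binder-literally: for `w ∈ W_K` and any `s`,
`s·h_K⁴ + w` lies in the line `ℂ·h_K⁴` iff `w = 0`, and lies in the balanced part `χ_{4,4} ⊇ ℚ[h_K]₈` iff `w = 0`. -/
theorem symH_smul_cupPowTwo_add_mem_span_iff (hψ : ψ₀ ≫ ψ₀ = -(1 • 𝟙 E₀)) (e : ProjectiveEmbedding (pad4Anchor E₀).X)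
    (a : complexBetti (projectiveSpace e.n ℂ) 2) (s : ℂ) {w : complexBetti (pad4Anchor E₀).X (2 * 4)}
    (hw : w ∈ weilClassesOf (pad4Anchor E₀) (pad4Action E₀ ψ₀) 4 1) :
    s • cupPowTwo (symH (pad4Action E₀ ψ₀) e a) 4 + w ∈ ℂ ∙ cupPowTwo (symH (pad4Action E₀ ψ₀) e a) 4 ↔ w = 0 := by
  constructor
  · intro hmem
    obtain ⟨t, ht⟩ := Submodule.mem_span_singleton.mp hmem
    have key := symH_smul_cupPowTwo_add_weil_unique hψ e a (s := t) (s' := s) (Submodule.zero_mem _) hw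
      (by rw [add_zero, ht])
    exact key.2.symm
  · rintro rfl
    exact Submodule.mem_span_singleton.mpr ⟨s, by rw [add_zero]⟩

theorem symH_smul_cupPowTwo_add_mem_balanced_iff (hψ : ψ₀ ≫ ψ₀ = -(1 • 𝟙 E₀))
    (e : ProjectiveEmbedding (pad4Anchor E₀).X) (a : complexBetti (projectiveSpace e.n ℂ) 2) (s : ℂ)
    {w : complexBetti (pad4Anchor E₀).X (2 * 4)} (hw : w ∈ weilClassesOf (pad4Anchor E₀) (pad4Action E₀ ψ₀) 4 1) :
    s • cupPowTwo (symH (pad4Action E₀ ψ₀) e a) 4 + w ∈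
        pullbackEigenclasses (pad4Anchor E₀) (pad4Action E₀ ψ₀) (2 * 4) (balancedChar 1 4) ↔ w = 0 := by
  constructor
  · intro hmem
    have key := eq_of_balanced_add_weil_eq (by norm_num) one_pos hmem
      (Submodule.smul_mem _ s (cupPowTwo_symH_mem_balanced hψ e a 4)) (Submodule.zero_mem _) hw (add_zero _)
    exact key.2.symm
  · rintro rfl
    rw [add_zero]
    exact Submodule.smul_mem _ _ (cupPowTwo_symH_mem_balanced hψ e a 4)

/-- **THE `W`-COORDINATE `μ` OF A CLASS `s·h⁴ + wOf μ` IS WELL DEFINED** for any balanced `h` (e.g. `h_std`, `h_K`):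
`s·h⁴ + wOf μ = s'·h⁴ + wOf μ'` ⟹ `μ = μ'` ∧ `s·h⁴ = s'·h⁴`. -/
theorem WeilFrame.mu_eq_of_eq (F : WeilFrame E₀ ψ₀) {h : complexBetti (pad4Anchor E₀).X 2}
    (hh : h ∈ pullbackEigenclasses (pad4Anchor E₀) (pad4Action E₀ ψ₀) 2 (balancedChar 1 1)) {s s' : ℂ}
    {μ μ' : GaussianInt} (h' : s • cupPowTwo h 4 + F.wOf μ = s' • cupPowTwo h 4 + F.wOf μ') :
    μ = μ' ∧ s • cupPowTwo h 4 = s' • cupPowTwo h 4 := by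
  have key := eq_of_balanced_add_weil_eq (by norm_num) one_pos
    (Submodule.smul_mem _ _ (cupPowTwo_mem_balanced hh 4)) (Submodule.smul_mem _ _ (cupPowTwo_mem_balanced hh 4))
    (F.wOf_mem μ) (F.wOf_mem μ') h'
  exact ⟨F.eq_of_wOf_eq key.2, key.1⟩

/-- **(A1@Z) NAMES ONE `μ`**: two (A1@Z) readings of the same sheaf against the same balanced `h` have the same
`W`-coordinate — `μ` is a property of `ch₄(𝓔)`, not of the chosen coefficient witnesses. -/
theorem cleanAtSeed_mu_unique {C : ChernCharacterBetti} {I : Finset ℕ} {F : WeilFrame E₀ ψ₀}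
    {h : complexBetti (pad4Anchor E₀).X 2} {𝓔 : (pad4Anchor E₀).X.left.Modules} {μ μ' : GaussianInt}
    (hh : h ∈ pullbackEigenclasses (pad4Anchor E₀) (pad4Action E₀ ψ₀) 2 (balancedChar 1 1))
    (h₁ : CleanAtSeed C I F h 𝓔 μ) (h₂ : CleanAtSeed C I F h 𝓔 μ') : μ = μ' := by
  obtain ⟨_, q, -, hq⟩ := h₁
  obtain ⟨_, q', -, hq'⟩ := h₂
  exact (F.mu_eq_of_eq hh (hq.symm.trans hq')).1

theorem cleanAtSeed_hStd_mu_unique (hE : E₀.dim = 1) (hψ : ψ₀ ≫ ψ₀ = -(1 • 𝟙 E₀)) {C : ChernCharacterBetti}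
    {I : Finset ℕ} {F : WeilFrame E₀ ψ₀} {η : complexBetti E₀.X 2} {𝓔 : (pad4Anchor E₀).X.left.Modules}
    {μ μ' : GaussianInt} (h₁ : CleanAtSeed C I F (hStd E₀ η) 𝓔 μ) (h₂ : CleanAtSeed C I F (hStd E₀ η) 𝓔 μ') :
    μ = μ' :=
  cleanAtSeed_mu_unique (hStd_mem_balanced hE one_pos hψ η) h₁ h₂

theorem cleanAtSeed_symH_mu_unique (hψ : ψ₀ ≫ ψ₀ = -(1 • 𝟙 E₀)) {C : ChernCharacterBetti} {I : Finset ℕ}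
    {F : WeilFrame E₀ ψ₀} (e : ProjectiveEmbedding (pad4Anchor E₀).X) (a : complexBetti (projectiveSpace e.n ℂ) 2)
    {𝓔 : (pad4Anchor E₀).X.left.Modules} {μ μ' : GaussianInt}
    (h₁ : CleanAtSeed C I F (symH (pad4Action E₀ ψ₀) e a) 𝓔 μ)
    (h₂ : CleanAtSeed C I F (symH (pad4Action E₀ ψ₀) e a) 𝓔 μ') : μ = μ' :=
  cleanAtSeed_mu_unique (symH_mem_balanced hψ e a) h₁ h₂

/-- **ONE SHEAF REALISES ONE `μ`**: if two designs are realised by the same sheaf (same `C`, frame and balanced `h`),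
their `eeee`-coefficients agree. -/
theorem realisedBy_mu_eq {D D' : Design} {C : ChernCharacterBetti} {F : WeilFrame E₀ ψ₀}
    {h : complexBetti (pad4Anchor E₀).X 2} {𝓔 : (pad4Anchor E₀).X.left.Modules}
    (hh : h ∈ pullbackEigenclasses (pad4Anchor E₀) (pad4Action E₀ ψ₀) 2 (balancedChar 1 1))
    (h₁ : D.RealisedBy C F h 𝓔) (h₂ : D'.RealisedBy C F h 𝓔) : D.mu = D'.mu :=
  (F.mu_eq_of_eq hh (h₁.2.2.symm.trans h₂.2.2)).1

/-- **(σ) HONEST, balanced form: `s·h⁴ + wOf μ` is balanced (⊇ `ℚ[h]₈`) iff `μ = 0`.** -/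
theorem smul_cupPowTwo_add_wOf_mem_balanced_iff (F : WeilFrame E₀ ψ₀) {h : complexBetti (pad4Anchor E₀).X 2}
    (hh : h ∈ pullbackEigenclasses (pad4Anchor E₀) (pad4Action E₀ ψ₀) 2 (balancedChar 1 1)) (s : ℂ)
    (μ : GaussianInt) :
    s • cupPowTwo h 4 + F.wOf μ ∈ pullbackEigenclasses (pad4Anchor E₀) (pad4Action E₀ ψ₀) (2 * 4) (balancedChar 1 4) ↔
      μ = 0 := by
  constructor
  · intro hmem
    have key := eq_of_balanced_add_weil_eq (by norm_num) one_pos hmem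
      (Submodule.smul_mem _ s (cupPowTwo_mem_balanced hh 4)) (Submodule.zero_mem _) (F.wOf_mem μ) (add_zero _)
    exact F.eq_of_wOf_eq (by rw [← key.2, WeilFrame.wOf_zero])
  · rintro rfl
    rw [WeilFrame.wOf_zero, add_zero]
    exact Submodule.smul_mem _ _ (cupPowTwo_mem_balanced hh 4)

/-- **(σ) HONEST, line form: `s·h⁴ + wOf μ ∈ ℂ·h⁴` iff `μ = 0`** — the class passes the Hodge-class check («not a
polynomial in the divisor class») EXACTLY when its design `eeee`-coefficient is non-zero; v4's `ClassCheck`'s first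
conjunct `μ ≠ 0` is therefore the whole (σ)-design-half, not a proxy. -/
theorem smul_cupPowTwo_add_wOf_mem_span_iff (F : WeilFrame E₀ ψ₀) {h : complexBetti (pad4Anchor E₀).X 2}
    (hh : h ∈ pullbackEigenclasses (pad4Anchor E₀) (pad4Action E₀ ψ₀) 2 (balancedChar 1 1)) (s : ℂ)
    (μ : GaussianInt) : s • cupPowTwo h 4 + F.wOf μ ∈ ℂ ∙ cupPowTwo h 4 ↔ μ = 0 := by
  constructor
  · intro hmem
    obtain ⟨t, ht⟩ := Submodule.mem_span_singleton.mp hmem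
    have key := F.mu_eq_of_eq hh (s := t) (s' := s) (μ := 0) (μ' := μ) (by rw [WeilFrame.wOf_zero, add_zero, ht])
    exact key.1.symm
  · rintro rfl
    exact Submodule.mem_span_singleton.mpr ⟨s, by rw [WeilFrame.wOf_zero, add_zero]⟩

/-- **a class passing v4's `ClassCheck` (σ) is NOT in the line `ℂ·h_K⁴`** (nor anywhere in the balanced part). -/
theorem ClassCheck.not_mem_span (hψ : ψ₀ ≫ ψ₀ = -(1 • 𝟙 E₀)) {K : AnchorKit E₀ ψ₀} {μ : GaussianInt}
    {Z : Scheme.{0}} {i : Z ⟶ (pad4Anchor E₀).X.left} {q : ℚ} (hc : ClassCheck K μ i q) :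
    ((q : ℚ) : ℂ) • cupPowTwo (symH (pad4Action E₀ ψ₀) K.pol.e K.pol.a) 4 + K.F.wOf μ ∉
      ℂ ∙ cupPowTwo (symH (pad4Action E₀ ψ₀) K.pol.e K.pol.a) 4 :=
  fun hmem => hc.1 ((smul_cupPowTwo_add_wOf_mem_span_iff K.F (symH_mem_balanced hψ K.pol.e K.pol.a) _ μ).mp hmem)

theorem ClassCheck.not_mem_balanced (hψ : ψ₀ ≫ ψ₀ = -(1 • 𝟙 E₀)) {K : AnchorKit E₀ ψ₀} {μ : GaussianInt}
    {Z : Scheme.{0}} {i : Z ⟶ (pad4Anchor E₀).X.left} {q : ℚ} (hc : ClassCheck K μ i q) :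
    ((q : ℚ) : ℂ) • cupPowTwo (symH (pad4Action E₀ ψ₀) K.pol.e K.pol.a) 4 + K.F.wOf μ ∉
      pullbackEigenclasses (pad4Anchor E₀) (pad4Action E₀ ψ₀) (2 * 4) (balancedChar 1 4) :=
  fun hmem => hc.1 ((smul_cupPowTwo_add_wOf_mem_balanced_iff K.F (symH_mem_balanced hψ K.pol.e K.pol.a) _ μ).mp hmem)

/-- the certificate's supported class is not in `ℂ·h_K⁴`. -/
theorem SeedCertificate.supported_not_mem_span (hψ : ψ₀ ≫ ψ₀ = -(1 • 𝟙 E₀)) (c : SeedCertificate E₀ ψ₀) :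
    ((c.q : ℚ) : ℂ) • cupPowTwo (symH (pad4Action E₀ ψ₀) c.kit.pol.e c.kit.pol.a) 4 + c.kit.F.wOf c.μ ∉
      ℂ ∙ cupPowTwo (symH (pad4Action E₀ ψ₀) c.kit.pol.e c.kit.pol.a) 4 :=
  fun hmem => c.μ_ne_zero
    ((smul_cupPowTwo_add_wOf_mem_span_iff c.kit.F (symH_mem_balanced hψ c.kit.pol.e c.kit.pol.a) _ c.μ).mp hmem)

end CheckerConsequences

/-! ## §11.5 `h_Kᵖ ≠ 0` for `p ≤ 8` (Kähler): the `h⁴`-coordinate and every window coefficient are determined too -/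

section Coefficients

open scoped Manifold ContDiff
open Literature.Geometry.Kaehler Literature.NumberTheory.Transcendental
open Literature.AlgebraicGeometry.Motives.AnalytificationKaehler (fubiniStudyPullbackForm)

variable {E₀ : AbelianVariety ℂ} {ψ₀ : E₀ ⟶ E₀}

private theorem cupPowTwo_smul_v8 {Y : Type} [TopologicalSpace Y] (t : ℂ) (x : singularCohomology ℂ ℂ Y 2)
    (i : ℕ) : cupPowTwo (t • x) i = t ^ i • cupPowTwo x i := by
  induction i with
  | zero => rw [cupPowTwo_zero, cupPowTwo_zero, pow_zero, one_smul]
  | succ i ih =>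
    rw [cupPowTwo_succ, cupPowTwo_succ, ih]
    simp only [map_smul, LinearMap.smul_apply, smul_smul, pow_succ, mul_comm]

/-- `x¹ ≠ 0 ⟹ x⁰ = 1 ≠ 0` (`x¹ = x⁰ ∪ x`). -/
theorem cupPowTwo_zero_ne_zero_of_one {Y : Type} [TopologicalSpace Y] {x : singularCohomology ℂ ℂ Y 2}
    (h1 : cupPowTwo x 1 ≠ 0) : cupPowTwo x 0 ≠ 0 := by
  intro h0
  apply h1
  rw [cupPowTwo_succ, h0, map_zero, LinearMap.zero_apply]

/-- **`(e^*a)ᵖ ≠ 0` on the pad-4 anchor for `1 ≤ p ≤ 8`**, for every projective embedding `e` and rational `a ≠ 0`: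
`e^*a = s·H` with `s ∈ ℝ ∖ 0` and `H` the (Kähler) class of the restricted Fubini–Study form, and `Hᵖ ≠ 0` for
`p ≤ dim = 8`. [cite: VoisinHodgeI2002, §3.3.2 Lemma 3.16 and Cor. 3.9; Thm. 7.10] -/
theorem cupPowTwo_map_ι_ne_zero (hE : E₀.dim = 1) (e : ProjectiveEmbedding (pad4Anchor E₀).X)
    {a : complexBetti (projectiveSpace e.n ℂ) 2} (ha : IsRationalClass a) (ha0 : a ≠ 0) {p : ℕ} (hp1 : 1 ≤ p)
    (hp8 : p ≤ 8) : cupPowTwo (complexBetti.map e.ι 2 a) p ≠ 0 := by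
  have hX' : IsSmoothProjective (2 * 4) (pad4Anchor E₀).X := isSmoothProjective_of_dim_eq' (pad4Anchor_dim hE)
  obtain ⟨M⟩ := nonempty_hodgeModel_holds.nonempty hX'
  obtain ⟨eR, heR, hem, -⟩ := exists_deRhamIsoFamily_holds M.model
  have hθ := M.fubiniStudyPullbackForm_mem_closedSmoothForms e.ι
  obtain ⟨HK, hHK⟩ := M.pullback_surjective 2 (ofRealClass M.carrier 2 (eR M.carrier 2
    (deRhamCohomology.mk ⟨fubiniStudyPullbackForm M.model e.ι M.toComplexPoints, hθ⟩)))
  have hKvia : M.IsKaehlerClassVia eR HK :=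
    M.isKaehlerClassVia_of_pullback_eq_fubiniStudyPullbackForm eR hX' e.ι hθ hHK
  obtain ⟨s, hs0, hsa⟩ :=
    exists_real_map_eq_smul_of_pullback_eq_fubiniStudy hX' (by norm_num) M e.ι eR heR hθ hHK ha ha0
  rw [hsa, cupPowTwo_smul_v8]
  exact smul_ne_zero (pow_ne_zero _ (Complex.ofReal_ne_zero.mpr hs0))
    ((hKvia.isKaehlerClass heR hem).cupPowTwo_ne_zero hX' hp1 (by omega))

/-- **`h_Kᵖ ≠ 0` for `1 ≤ p ≤ 8` and EVERY `(e, a)`** (`a` rational, `≠ 0`): `h_K = e^*a + ψ^*e^*a = s·(H + ψ^*H)` and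
`H + ψ^*H` is again Kähler (`IsKaehlerClassVia.natCast_smul_add_map`). -/
theorem cupPowTwo_symH_ne_zero (hE : E₀.dim = 1) (e : ProjectiveEmbedding (pad4Anchor E₀).X)
    {a : complexBetti (projectiveSpace e.n ℂ) 2} (ha : IsRationalClass a) (ha0 : a ≠ 0) {p : ℕ} (hp1 : 1 ≤ p)
    (hp8 : p ≤ 8) : cupPowTwo (symH (pad4Action E₀ ψ₀) e a) p ≠ 0 := by
  have hX' : IsSmoothProjective (2 * 4) (pad4Anchor E₀).X := isSmoothProjective_of_dim_eq' (pad4Anchor_dim hE)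
  obtain ⟨M⟩ := nonempty_hodgeModel_holds.nonempty hX'
  obtain ⟨eR, heR, hem, -⟩ := exists_deRhamIsoFamily_holds M.model
  have hθ := M.fubiniStudyPullbackForm_mem_closedSmoothForms e.ι
  obtain ⟨HK, hHK⟩ := M.pullback_surjective 2 (ofRealClass M.carrier 2 (eR M.carrier 2
    (deRhamCohomology.mk ⟨fubiniStudyPullbackForm M.model e.ι M.toComplexPoints, hθ⟩)))
  have hKvia : M.IsKaehlerClassVia eR HK :=
    M.isKaehlerClassVia_of_pullback_eq_fubiniStudyPullbackForm eR hX' e.ι hθ hHK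
  obtain ⟨s, hs0, hsa⟩ :=
    exists_real_map_eq_smul_of_pullback_eq_fubiniStudy hX' (by norm_num) M e.ι eR heR hθ hHK ha ha0
  have hK' : IsKaehlerClass (2 * 4) (pad4Anchor E₀).X
      (((1 : ℕ) : ℂ) • HK + complexBetti.map (pad4Action E₀ ψ₀).hom.hom.hom 2 HK) :=
    (hKvia.natCast_smul_add_map heR hX' (pad4Action E₀ ψ₀).hom.hom.hom one_pos).isKaehlerClass heR hem
  have hsym : symH (pad4Action E₀ ψ₀) e a =
      (s : ℂ) • (((1 : ℕ) : ℂ) • HK + complexBetti.map (pad4Action E₀ ψ₀).hom.hom.hom 2 HK) := by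
    change ((1 : ℕ) : ℂ) • complexBetti.map e.ι 2 a +
      complexBetti.map (pad4Action E₀ ψ₀).hom.hom.hom 2 (complexBetti.map e.ι 2 a) = _
    rw [hsa, map_smul, smul_add, smul_comm]
  rw [hsym, cupPowTwo_smul_v8]
  exact smul_ne_zero (pow_ne_zero _ (Complex.ofReal_ne_zero.mpr hs0)) (hK'.cupPowTwo_ne_zero hX' hp1 (by omega))

/-- **`h_stdᵖ ≠ 0` for `p ≤ 8`** once a polarisation datum `e^*a = t·h_std` (v4 `Polarisation`, obligation O-pol) is
given. -/
theorem cupPowTwo_hStd_ne_zero (hE : E₀.dim = 1) {η : complexBetti E₀.X 2} (P : Polarisation E₀ η) {p : ℕ}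
    (hp8 : p ≤ 8) : cupPowTwo (hStd E₀ η) p ≠ 0 := by
  have key : ∀ p, 1 ≤ p → p ≤ 8 → cupPowTwo (hStd E₀ η) p ≠ 0 := by
    intro p hp1 hp8 h0
    have h := cupPowTwo_map_ι_ne_zero hE P.e P.a_rational P.a_ne_zero hp1 hp8
    rw [P.pullback_eq, cupPowTwo_smul_v8, h0, smul_zero] at h
    exact h rfl
  rcases Nat.lt_or_ge p 1 with hp | hp
  · obtain rfl : p = 0 := by omega
    exact cupPowTwo_zero_ne_zero_of_one (key 1 le_rfl (by norm_num))
  · exact key p hp hp8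

theorem cupPowTwo_symH_ne_zero' (hE : E₀.dim = 1) (e : ProjectiveEmbedding (pad4Anchor E₀).X)
    {a : complexBetti (projectiveSpace e.n ℂ) 2} (ha : IsRationalClass a) (ha0 : a ≠ 0) {p : ℕ} (hp8 : p ≤ 8) :
    cupPowTwo (symH (pad4Action E₀ ψ₀) e a) p ≠ 0 := by
  rcases Nat.lt_or_ge p 1 with hp | hp
  · obtain rfl : p = 0 := by omega
    exact cupPowTwo_zero_ne_zero_of_one (cupPowTwo_symH_ne_zero hE e ha ha0 le_rfl (by norm_num))
  · exact cupPowTwo_symH_ne_zero hE e ha ha0 hp hp8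

/-- **BOTH COORDINATES ARE DETERMINED**: for a balanced `h` with `h⁴ ≠ 0`, `s·h⁴ + wOf μ = s'·h⁴ + wOf μ'` forces `μ = μ'`
AND `s = s'`. -/
theorem WeilFrame.mu_eq_and_eq_of_eq (F : WeilFrame E₀ ψ₀) {h : complexBetti (pad4Anchor E₀).X 2}
    (hh : h ∈ pullbackEigenclasses (pad4Anchor E₀) (pad4Action E₀ ψ₀) 2 (balancedChar 1 1)) (h4 : cupPowTwo h 4 ≠ 0)
    {s s' : ℂ} {μ μ' : GaussianInt} (h' : s • cupPowTwo h 4 + F.wOf μ = s' • cupPowTwo h 4 + F.wOf μ') :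
    μ = μ' ∧ s = s' := by
  obtain ⟨hμ, hs⟩ := F.mu_eq_of_eq hh h'
  exact ⟨hμ, smul_left_injective ℂ h4 hs⟩

/-- for the stub's binders: `q·h_K⁴ + wOf μ = q'·h_K⁴ + wOf μ'` ⟹ `μ = μ'` ∧ `q = q'` (`q, q' ∈ ℚ`). -/
theorem symH_ratCast_smul_add_wOf_injective (hE : E₀.dim = 1) (hψ : ψ₀ ≫ ψ₀ = -(1 • 𝟙 E₀)) (F : WeilFrame E₀ ψ₀)
    (e : ProjectiveEmbedding (pad4Anchor E₀).X) {a : complexBetti (projectiveSpace e.n ℂ) 2} (ha : IsRationalClass a)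
    (ha0 : a ≠ 0) {q q' : ℚ} {μ μ' : GaussianInt}
    (h : ((q : ℚ) : ℂ) • cupPowTwo (symH (pad4Action E₀ ψ₀) e a) 4 + F.wOf μ =
      ((q' : ℚ) : ℂ) • cupPowTwo (symH (pad4Action E₀ ψ₀) e a) 4 + F.wOf μ') : μ = μ' ∧ q = q' := by
  obtain ⟨hμ, hq⟩ := F.mu_eq_and_eq_of_eq (symH_mem_balanced hψ e a)
    (cupPowTwo_symH_ne_zero hE e ha ha0 (by norm_num) (by norm_num)) h
  exact ⟨hμ, by exact_mod_cast hq⟩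

/-- **ONE SHEAF REALISES ONE CLASS-DATA VECTOR** (sheaf door, against `h_std` with a polarisation datum): two designs
realised by the same sheaf have the same `μ` and the same coefficients `c_p`, `p ≤ 8` — the dictionary
(design tensor ↦ `ch(𝓔) ∈ ℚ[h] ⊕ W_ℚ`) is injective on the data the checker reads. -/
theorem realisedBy_coeff_eq (hE : E₀.dim = 1) (hψ : ψ₀ ≫ ψ₀ = -(1 • 𝟙 E₀)) {η : complexBetti E₀.X 2}
    (P : Polarisation E₀ η) {D D' : Design} {C : ChernCharacterBetti} {F : WeilFrame E₀ ψ₀}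
    {𝓔 : (pad4Anchor E₀).X.left.Modules} (h₁ : D.RealisedBy C F (hStd E₀ η) 𝓔)
    (h₂ : D'.RealisedBy C F (hStd E₀ η) 𝓔) (p : Fin 9) : D.coeff p = D'.coeff p := by
  have hh := hStd_mem_balanced hE one_pos hψ η
  have hp8 : (p : ℕ) ≤ 8 := by omega
  have hne := cupPowTwo_hStd_ne_zero hE P hp8
  by_cases hp4 : (p : ℕ) = 4
  · have hp : p = 4 := Fin.ext hp4
    subst hp
    obtain ⟨-, hs⟩ := F.mu_eq_and_eq_of_eq hh hne (h₁.2.2.symm.trans h₂.2.2)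
    have hs' : ((D.coeff 4 : ℤ) : ℚ) / 24 = ((D'.coeff 4 : ℤ) : ℚ) / 24 := by exact_mod_cast hs
    exact_mod_cast (div_left_inj' (by norm_num)).mp hs'
  · have e₁ := h₁.2.1 p hp4
    have e₂ := h₂.2.1 p hp4
    rw [e₁] at e₂
    have hs := smul_left_injective ℂ hne e₂
    have hs' : ((D.coeff p : ℤ) : ℚ) / ((p : ℕ).factorial : ℚ) = ((D'.coeff p : ℤ) : ℚ) / ((p : ℕ).factorial : ℚ) := by
      exact_mod_cast hs
    have hf : (((p : ℕ).factorial : ℕ) : ℚ) ≠ 0 := by exact_mod_cast (Nat.factorial_pos _).ne'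
    exact_mod_cast (div_left_inj' hf).mp hs'

theorem realisedBy_unique (hE : E₀.dim = 1) (hψ : ψ₀ ≫ ψ₀ = -(1 • 𝟙 E₀)) {η : complexBetti E₀.X 2}
    (P : Polarisation E₀ η) {D D' : Design} {C : ChernCharacterBetti} {F : WeilFrame E₀ ψ₀}
    {𝓔 : (pad4Anchor E₀).X.left.Modules} (h₁ : D.RealisedBy C F (hStd E₀ η) 𝓔)
    (h₂ : D'.RealisedBy C F (hStd E₀ η) 𝓔) : D.mu = D'.mu ∧ ∀ p : Fin 9, D.coeff p = D'.coeff p :=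
  ⟨realisedBy_mu_eq (hStd_mem_balanced hE one_pos hψ η) h₁ h₂, realisedBy_coeff_eq hE hψ P h₁ h₂⟩

/-- kit form: two designs passing the sheaf-seed checker with the SAME sheaf have the same `(μ, c₀, …, c₈)`. -/
theorem sheafSeedCheck_unique (hE : E₀.dim = 1) (hψ : ψ₀ ≫ ψ₀ = -(1 • 𝟙 E₀)) {D D' : Design}
    {C : ChernCharacterBetti} {I I' : Finset ℕ} {K : AnchorKit E₀ ψ₀} {𝓔 : (pad4Anchor E₀).X.left.Modules}
    (h₁ : D.SheafSeedCheck C I K 𝓔) (h₂ : D'.SheafSeedCheck C I' K 𝓔) :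
    D.mu = D'.mu ∧ ∀ p : Fin 9, D.coeff p = D'.coeff p :=
  realisedBy_unique hE hψ K.pol h₁.2.2.2.2 h₂.2.2.2.2

end Coefficients

end Summit.HodgeConjecture.HodgeConjecture.Cruxes.BlochSeedDiscOne.SeedChecker

end
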